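/-
Copyright (c) 2026. All rights reserved.
Released under Apache 2.0 license as described in the file LICENSE.
Authors: abc-iut cell, campaign-S prover seat abc-iut-S1 (wave 1).
-/
import Mathlib.Analysis.SpecificLimits.Basic
import Mathlib.NumberTheory.Padics.PadicVal.Basic
import Mathlib.Algebra.Order.Ring.Pow
import Literature.IUT.LogVolume.LocalUnitLog
import HarnessLib

/-!
# Estimates for the `p`-adic logarithmic series: contraction, surjectivity onto small balls, injectivity

Companion of `LocalUnitLog.lean` (the `p`-adic logarithm `log_p` on `𝒪_K^×` of a mixed-characteristic
local field `K`, [IUTchIV] §1 Prop. 1.2 p. 10) supplying "the well-known theory of the `p`-adic logarithm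
and exponential maps [cf., e.g., [Kobl], p. 81]" that [IUTchIV] Prop. 1.2 (i) invokes (proof, kurims
p. 11), in the norm-side setting `[NormedAlgebra ℚ_[p] K] [IsUltrametricDist K] [CompleteSpace K]` and
WITHOUT the exponential:

* `norm_logTerm_eq` — the `n`-th term of `L(y) = -Σ (1-y)ⁿ/n` has norm `‖1-y‖^(n+1)·p^{v_p(n+1)}`
  (`‖1/N‖ = p^{v_p(N)}`), and `v_p(N) ≤ (N−1)/(p−1)` (`padicValNat_le_div`);
* `norm_logSeries_add_le` — the CONTRACTION estimate: for `‖1−y‖ ≤ ρ` with `θ := ρ·p^{1/(p−1)} ≤ 1`,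
  `‖L(y) + (1−y)‖ ≤ θ·‖1−y‖`; hence the Lipschitz bound `‖L(y)‖ ≤ ‖1−y‖` (`norm_logSeries_le_norm`);
* `exists_logSeries_eq` — for `θ < 1` every `z` with `‖z‖ ≤ ρ` is `L(u)` with `‖1−u‖ ≤ ρ` (successive
  approximation `u_{k+1} = u_k·(1 + z − L(u_k))` in the complete `K`);
* `logSeries_injOn`, `logSeries_image_closedBall` — `L` restricts to a bijection
  `{‖1−y‖ ≤ ρ} → {‖z‖ ≤ ρ}` (the classical isomorphism `log : U^{(n)} ≅ 𝔪ⁿ`, `n > e/(p−1)`).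

Classical (Koblitz, *p-adic Numbers, p-adic Analysis, and Zeta-Functions*, GTM 58, Ch. IV §1–2;
Neukirch ANT II (5.5)); nothing disputed.  The radius statement of [IUTchIV] Prop. 1.2 (i) itself is
`LogRadius.lean`.
-/

noncomputable section

open Filter Metric Finset
open _root_.Topology
open IsUltrametricDist

namespace Literature.IUT.LogVolume

open Literature.NumberTheory.Transcendental

variable (p : ℕ) [Fact p.Prime]
variable (K : Type*) [NontriviallyNormedField K] [instK : NormedAlgebra ℚ_[p] K]

/-! ## Norms of the terms of the logarithmic series -/

omit instK in
/-- `v_p(n) ≤ (n − 1)/(p − 1)` for `n ≥ 1` (`n ≥ p^{v} ≥ 1 + v(p−1)`, Bernoulli).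
[cite: Koblitz1984, Ch. IV §1] -/
theorem padicValNat_le_div {n : ℕ} (hn : n ≠ 0) :
    (padicValNat p n : ℝ) ≤ ((n : ℝ) - 1) / ((p : ℝ) - 1) := by
  have hp : p.Prime := Fact.out
  have hp1 : (1 : ℝ) < p := by exact_mod_cast hp.one_lt
  have hdvd : p ^ padicValNat p n ∣ n := pow_padicValNat_dvd
  have hle : p ^ padicValNat p n ≤ n := Nat.le_of_dvd (Nat.pos_of_ne_zero hn) hdvd
  have hB : 1 + (padicValNat p n : ℝ) * ((p : ℝ) - 1) ≤ (p : ℝ) ^ padicValNat p n := by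
    have := one_add_mul_le_pow (show (-2 : ℝ) ≤ (p : ℝ) - 1 by linarith) (padicValNat p n)
    simpa using this
  have hle' : ((p : ℝ)) ^ padicValNat p n ≤ n := by exact_mod_cast hle
  rw [le_div_iff₀ (by linarith)]
  linarith

/-! ## Norms of the terms of the logarithmic series -/

/-- `‖(n+1)⁻¹‖ = p^{v_p(n+1)}` in `K` (the norm of `K` restricts to `|·|_p` on `ℚ`).
[cite: Koblitz1984, Ch. IV §1] -/
theorem norm_inv_natCast_succ (n : ℕ) : ‖((n : K) + 1)⁻¹‖ = (p : ℝ) ^ padicValNat p (n + 1) := by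
  have h0 : ((n + 1 : ℕ) : ℚ_[p]) ≠ 0 := by exact_mod_cast Nat.succ_ne_zero n
  have h1 : ‖((n : K) + 1)‖ = ‖((n + 1 : ℕ) : ℚ_[p])‖ := by
    rw [← IwasawaLog.norm_natCast p (F := K) (n + 1)]
    push_cast
    rfl
  rw [norm_inv, h1, Padic.norm_eq_zpow_neg_valuation h0, Padic.valuation_natCast, zpow_neg, inv_inv,
    zpow_natCast]

/-- The `n`-th term of `L(y)`: `‖-(1-y)^(n+1)/(n+1)‖ = ‖1-y‖^(n+1) · p^{v_p(n+1)}`.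
[cite: Koblitz1984, Ch. IV §1] -/
theorem norm_logTerm_eq (y : K) (n : ℕ) :
    ‖-((1 - y) ^ (n + 1)) / (n + 1 : K)‖ = ‖1 - y‖ ^ (n + 1) * (p : ℝ) ^ padicValNat p (n + 1) := by
  rw [norm_div, norm_neg, norm_pow, div_eq_mul_inv, ← norm_inv, norm_inv_natCast_succ p K n]

/-- `p^{v_p(n+1)} ≤ (p^{1/(p−1)})^n` (from `v_p(n+1) ≤ n/(p−1)`). [cite: Koblitz1984, Ch. IV §1] -/
theorem pow_padicValNat_le_rpow (n : ℕ) :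
    (p : ℝ) ^ padicValNat p (n + 1) ≤ ((p : ℝ) ^ (1 / ((p : ℝ) - 1))) ^ n := by
  have hp1 : (1 : ℝ) < p := by exact_mod_cast (Fact.out : p.Prime).one_lt
  have hv := padicValNat_le_div p (Nat.succ_ne_zero n)
  rw [← Real.rpow_natCast, ← Real.rpow_natCast, ← Real.rpow_mul (by linarith),
    Real.rpow_le_rpow_left_iff hp1]
  calc (padicValNat p (n + 1) : ℝ) ≤ (((n + 1 : ℕ) : ℝ) - 1) / ((p : ℝ) - 1) := hv
    _ = 1 / ((p : ℝ) - 1) * n := by push_cast; ring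

/-! ## The contraction estimate and successive approximation (lower inclusion) -/

section Contraction

variable [IsUltrametricDist K] [CompleteSpace K]

/-- **Contraction estimate**: if `‖1 − y‖ ≤ ρ` and `θ := ρ · p^{1/(p−1)} ≤ 1`, then
`‖L(y) + (1 − y)‖ ≤ θ · ‖1 − y‖` (the terms of `L(y) + (1−y) = −Σ_{n≥2} (1−y)ⁿ/n` have norm
`‖1−y‖ⁿ p^{v_p(n)} ≤ ‖1−y‖ · θ^{n−1}`). This is where "`a_i > 1/(p−1)`" enters.
[cite: Koblitz1984, Ch. IV §1] -/
theorem norm_logSeries_add_le {ρ : ℝ} (hθ : ρ * (p : ℝ) ^ (1 / ((p : ℝ) - 1)) ≤ 1) {y : K}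
    (hy : ‖1 - y‖ ≤ ρ) :
    ‖logSeries y + (1 - y)‖ ≤ ρ * (p : ℝ) ^ (1 / ((p : ℝ) - 1)) * ‖1 - y‖ := by
  have hp1 : (1 : ℝ) < p := by exact_mod_cast (Fact.out : p.Prime).one_lt
  set q : ℝ := (p : ℝ) ^ (1 / ((p : ℝ) - 1)) with hq
  have hq1 : 1 < q := Real.one_lt_rpow hp1 (div_pos one_pos (by linarith))
  have hρ0 : 0 ≤ ρ := (norm_nonneg _).trans hy
  have hρ1 : ρ < 1 := by
    by_contra h
    rw [not_lt] at h
    have : 1 < ρ * q := by nlinarith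
    linarith
  have hy1 : ‖1 - y‖ < 1 := hy.trans_lt hρ1
  set f : ℕ → K := fun n ↦ -((1 - y) ^ (n + 1)) / (n + 1 : K) with hf
  have hsum : HasSum f (logSeries y) := hasSum_logSeries p hy1
  have hshift : HasSum (fun n ↦ f (n + 1)) (logSeries y + (1 - y)) := by
    have h0 : ∑ i ∈ Finset.range 1, f i = -(1 - y) := by
      rw [Finset.sum_range_one, hf]
      simp only [Nat.cast_zero, zero_add, pow_one, div_one]
    have heq : logSeries y = (logSeries y + (1 - y)) + ∑ i ∈ Finset.range 1, f i := by
      rw [h0]; ring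
    rw [hasSum_nat_add_iff (f := f) 1, ← heq]
    exact hsum
  rw [← hshift.tsum_eq]
  refine IsUltrametricDist.norm_tsum_le_of_forall_le_of_nonneg (by positivity) fun n ↦ ?_
  rw [hf]
  dsimp only
  rw [show ((n + 1 : ℕ) : K) + 1 = ((n + 1 : ℕ) : K) + 1 from rfl]
  have hterm := norm_logTerm_eq p K y (n + 1)
  push_cast at hterm ⊢
  rw [hterm]
  -- `‖1-y‖^(n+2) p^{v_p(n+2)} ≤ ‖1-y‖ * ρ^(n+1) * q^(n+1) ≤ ρ q ‖1-y‖`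
  have hv : (p : ℝ) ^ padicValNat p (n + 1 + 1) ≤ q ^ (n + 1) := pow_padicValNat_le_rpow p (n + 1)
  have hs : ‖1 - y‖ ^ (n + 1 + 1) ≤ ‖1 - y‖ * ρ ^ (n + 1) := by
    rw [pow_succ']
    gcongr
  have hθn : (ρ * q) ^ (n + 1) ≤ ρ * q := by
    calc (ρ * q) ^ (n + 1) = (ρ * q) ^ n * (ρ * q) := pow_succ _ _
      _ ≤ 1 * (ρ * q) :=
          mul_le_mul_of_nonneg_right (pow_le_one₀ (by positivity) hθ) (by positivity)
      _ = ρ * q := one_mul _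
  calc ‖1 - y‖ ^ (n + 1 + 1) * (p : ℝ) ^ padicValNat p (n + 1 + 1)
      ≤ (‖1 - y‖ * ρ ^ (n + 1)) * q ^ (n + 1) := by gcongr
    _ = (ρ * q) ^ (n + 1) * ‖1 - y‖ := by rw [mul_pow]; ring
    _ ≤ (ρ * q) * ‖1 - y‖ := by gcongr

/-- **Lipschitz bound**: `‖L(y)‖ ≤ ‖1 − y‖` when `‖1 − y‖ ≤ ρ`, `ρ·p^{1/(p−1)} ≤ 1`.
[cite: Koblitz1984, Ch. IV §1] -/
theorem norm_logSeries_le_norm {ρ : ℝ} (hθ : ρ * (p : ℝ) ^ (1 / ((p : ℝ) - 1)) ≤ 1) {y : K}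
    (hy : ‖1 - y‖ ≤ ρ) : ‖logSeries y‖ ≤ ‖1 - y‖ := by
  have h := norm_logSeries_add_le p K hθ hy
  have h' : ‖logSeries y + (1 - y)‖ ≤ ‖1 - y‖ := by
    refine h.trans ?_
    calc ρ * (p : ℝ) ^ (1 / ((p : ℝ) - 1)) * ‖1 - y‖ ≤ 1 * ‖1 - y‖ := by gcongr
      _ = ‖1 - y‖ := one_mul _
  have : logSeries y = (logSeries y + (1 - y)) + (-(1 - y)) := by ring
  rw [this]
  refine (norm_add_le_max _ _).trans (max_le h' ?_)
  rw [norm_neg]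

/-- **Successive approximation** ("the `p`-adic logarithm is surjective onto `p^a·R` from
`1 + p^a·R`", proved without the exponential): if `θ := ρ·p^{1/(p−1)} < 1` then every `z` with
`‖z‖ ≤ ρ` is `L(u)` for some `u` with `‖1 − u‖ ≤ ρ`.  Iteration `u₀ = 1`,
`u_{k+1} = u_k·(1 + (z − L(u_k)))`: the residuals contract by `θ` (`norm_logSeries_add_le`), `(u_k)` is
Cauchy in the complete `K`, and `L(lim u_k) = z` by the Lipschitz bound.
[cite: Koblitz1984, Ch. IV §2] -/
theorem exists_logSeries_eq {ρ : ℝ} (hθ : ρ * (p : ℝ) ^ (1 / ((p : ℝ) - 1)) < 1) {z : K}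
    (hz : ‖z‖ ≤ ρ) : ∃ u : K, ‖1 - u‖ ≤ ρ ∧ logSeries u = z := by
  have hp1 : (1 : ℝ) < p := by exact_mod_cast (Fact.out : p.Prime).one_lt
  set θ : ℝ := ρ * (p : ℝ) ^ (1 / ((p : ℝ) - 1)) with hθdef
  have hq1 : 1 < (p : ℝ) ^ (1 / ((p : ℝ) - 1)) := Real.one_lt_rpow hp1 (div_pos one_pos (by linarith))
  have hρ0 : 0 ≤ ρ := (norm_nonneg _).trans hz
  have hθ0 : 0 ≤ θ := by positivity
  have hρθ : ρ ≤ θ := by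
    calc ρ = ρ * 1 := (mul_one ρ).symm
      _ ≤ θ := by rw [hθdef]; gcongr
  have hρ1 : ρ < 1 := hρθ.trans_lt hθ
  -- the iteration
  let u : ℕ → K := fun k ↦ Nat.rec (1 : K) (fun _ w ↦ w * (1 + (z - logSeries w))) k
  have hu0 : u 0 = 1 := rfl
  have husucc : ∀ k, u (k + 1) = u k * (1 + (z - logSeries (u k))) := fun _ ↦ rfl
  -- joint invariant
  have inv : ∀ k : ℕ, ‖1 - u k‖ ≤ ρ ∧ ‖z - logSeries (u k)‖ ≤ θ ^ k * ρ := by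
    intro k
    induction k with
    | zero =>
      refine ⟨by simp [hu0, hρ0], ?_⟩
      simpa [hu0] using hz
    | succ k ih =>
      obtain ⟨h1, h2⟩ := ih
      set r := z - logSeries (u k) with hr
      have hθk : θ ^ k * ρ ≤ ρ := by
        calc θ ^ k * ρ ≤ 1 * ρ := by gcongr; exact pow_le_one₀ hθ0 hθ.le
          _ = ρ := one_mul ρ
      have hrρ : ‖r‖ ≤ ρ := h2.trans hθk
      have huk1 : ‖u k‖ = 1 := IsPrincipal.norm_eq_one (h1.trans_lt hρ1)
      have hP1 : IsPrincipal (u k) := h1.trans_lt hρ1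
      have hP2 : IsPrincipal (1 + r) := by
        change ‖1 - (1 + r)‖ < 1
        rw [show (1 : K) - (1 + r) = -r by ring, norm_neg]
        exact hrρ.trans_lt hρ1
      refine ⟨?_, ?_⟩
      · rw [husucc, ← hr]
        have : (1 : K) - u k * (1 + r) = (1 - u k) + (-(u k * r)) := by ring
        rw [this]
        refine (norm_add_le_max _ _).trans (max_le h1 ?_)
        rw [norm_neg, norm_mul, huk1, one_mul]
        exact hrρ
      · rw [husucc, ← hr, logSeries_mul p hP1 hP2]
        have e1 : z - (logSeries (u k) + logSeries (1 + r)) = -(logSeries (1 + r) + (1 - (1 + r))) := by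
          rw [hr]; ring
        rw [e1, norm_neg]
        have h3 : ‖(1 : K) - (1 + r)‖ ≤ ρ := by
          rw [show (1 : K) - (1 + r) = -r by ring, norm_neg]; exact hrρ
        calc ‖logSeries (1 + r) + (1 - (1 + r))‖ ≤ θ * ‖(1 : K) - (1 + r)‖ :=
              norm_logSeries_add_le p K hθ.le h3
          _ = θ * ‖r‖ := by rw [show (1 : K) - (1 + r) = -r by ring, norm_neg]
          _ ≤ θ * (θ ^ k * ρ) := by gcongr
          _ = θ ^ (k + 1) * ρ := by ring
  -- Cauchy
  have hdist : ∀ k, dist (u k) (u (k + 1)) ≤ ρ * θ ^ k := by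
    intro k
    obtain ⟨h1, h2⟩ := inv k
    have huk1 : ‖u k‖ = 1 := IsPrincipal.norm_eq_one (h1.trans_lt hρ1)
    rw [dist_eq_norm, husucc, show u k - u k * (1 + (z - logSeries (u k))) =
      -(u k * (z - logSeries (u k))) by ring, norm_neg, norm_mul, huk1, one_mul, mul_comm]
    exact h2
  have hcauchy : CauchySeq u := cauchySeq_of_le_geometric θ ρ hθ hdist
  obtain ⟨w, hw⟩ := cauchySeq_tendsto_of_complete hcauchy
  -- the limit is in the closed ball
  have hw1 : ‖1 - w‖ ≤ ρ := by
    have ht : Tendsto (fun k ↦ ‖1 - u k‖) atTop (𝓝 ‖1 - w‖) :=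
      ((continuous_const.sub continuous_id).norm.tendsto w).comp hw
    exact le_of_tendsto' ht fun k ↦ (inv k).1
  refine ⟨w, hw1, ?_⟩
  -- `L(u_k) → z`
  have hLz : Tendsto (fun k ↦ logSeries (u k)) atTop (𝓝 z) := by
    rw [tendsto_iff_norm_sub_tendsto_zero]
    have hg : Tendsto (fun k : ℕ ↦ θ ^ k * ρ) atTop (𝓝 0) := by
      have := (tendsto_pow_atTop_nhds_zero_of_lt_one hθ0 hθ).mul_const ρ
      rwa [zero_mul] at this
    refine squeeze_zero (fun k ↦ norm_nonneg _) (fun k ↦ ?_) hg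
    rw [norm_sub_rev]; exact (inv k).2
  -- `L(u_k) → L(w)` by the Lipschitz bound
  have hwP : IsPrincipal w := hw1.trans_lt hρ1
  have hw0 : ‖w‖ = 1 := hwP.norm_eq_one
  have hLw : Tendsto (fun k ↦ logSeries (u k)) atTop (𝓝 (logSeries w)) := by
    rw [tendsto_iff_norm_sub_tendsto_zero]
    have hg : Tendsto (fun k ↦ ‖u k - w‖) atTop (𝓝 0) := by
      rwa [← tendsto_iff_norm_sub_tendsto_zero]
    refine squeeze_zero (fun k ↦ norm_nonneg _) (fun k ↦ ?_) hg
    obtain ⟨h1, -⟩ := inv k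
    have hukP : IsPrincipal (u k) := h1.trans_lt hρ1
    have huk1 : ‖u k‖ = 1 := hukP.norm_eq_one
    have hw0' : w ≠ 0 := norm_pos_iff.mp (by rw [hw0]; exact one_pos)
    -- `L(u_k) - L(w) = L(u_k w⁻¹)` and `‖1 - u_k w⁻¹‖ = ‖w - u_k‖ ≤ ρ`
    have hquot : IsPrincipal (u k * w⁻¹) := hukP.mul hwP.inv
    have hfe : logSeries (u k) = logSeries (u k * w⁻¹) + logSeries w := by
      rw [← logSeries_mul p hquot hwP, inv_mul_cancel_right₀ hw0']
    have hn : ‖1 - u k * w⁻¹‖ = ‖u k - w‖ := by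
      rw [show (1 : K) - u k * w⁻¹ = (w - u k) * w⁻¹ by field_simp, norm_mul, norm_inv, hw0,
        inv_one, mul_one, norm_sub_rev]
    have hle : ‖1 - u k * w⁻¹‖ ≤ ρ := by
      rw [hn, show u k - w = (1 - w) + (-(1 - u k)) by ring]
      refine (norm_add_le_max _ _).trans (max_le hw1 ?_)
      rw [norm_neg]; exact h1
    rw [hfe, add_sub_cancel_right]
    calc ‖logSeries (u k * w⁻¹)‖ ≤ ‖1 - u k * w⁻¹‖ := norm_logSeries_le_norm p K hθ.le hle
      _ = ‖u k - w‖ := hn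
  exact tendsto_nhds_unique hLw hLz

/-- **Injectivity of `L` on `1 + p^a·R`**: if `θ = ρ·p^{1/(p−1)} < 1` then `L` is injective on
`{‖1 − y‖ ≤ ρ}` (`L(y₁) = L(y₂)` gives `L(y₁y₂⁻¹) = 0`, and `‖L(w) + (1−w)‖ ≤ θ‖1−w‖` forces `w = 1`).
[cite: Koblitz1984, Ch. IV §2] -/
theorem logSeries_injOn {ρ : ℝ} (hθ : ρ * (p : ℝ) ^ (1 / ((p : ℝ) - 1)) < 1) :
    Set.InjOn (logSeries (K := K)) {y : K | ‖1 - y‖ ≤ ρ} := by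
  have hp1 : (1 : ℝ) < p := by exact_mod_cast (Fact.out : p.Prime).one_lt
  have hq1 : 1 < (p : ℝ) ^ (1 / ((p : ℝ) - 1)) := Real.one_lt_rpow hp1 (div_pos one_pos (by linarith))
  intro y₁ hy₁ y₂ hy₂ hL
  rw [Set.mem_setOf_eq] at hy₁ hy₂
  have hρ0 : 0 ≤ ρ := (norm_nonneg _).trans hy₁
  have hρ1 : ρ < 1 := by
    have : ρ ≤ ρ * (p : ℝ) ^ (1 / ((p : ℝ) - 1)) := by
      calc ρ = ρ * 1 := (mul_one ρ).symm
        _ ≤ _ := by gcongr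
    exact this.trans_lt hθ
  have hP₁ : IsPrincipal y₁ := hy₁.trans_lt hρ1
  have hP₂ : IsPrincipal y₂ := hy₂.trans_lt hρ1
  have hn₂ : ‖y₂‖ = 1 := hP₂.norm_eq_one
  have hy₂0 : y₂ ≠ 0 := norm_pos_iff.mp (by rw [hn₂]; exact one_pos)
  set w := y₁ * y₂⁻¹ with hw
  have hwP : IsPrincipal w := hP₁.mul hP₂.inv
  have hLw : logSeries w = 0 := by
    have : logSeries y₁ = logSeries w + logSeries y₂ := by
      rw [← logSeries_mul p hwP hP₂, hw, inv_mul_cancel_right₀ hy₂0]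
    rw [hL] at this
    linear_combination -this
  have hwn : ‖1 - w‖ = ‖y₁ - y₂‖ := by
    rw [hw, show (1 : K) - y₁ * y₂⁻¹ = (y₂ - y₁) * y₂⁻¹ by field_simp, norm_mul, norm_inv, hn₂,
      inv_one, mul_one, norm_sub_rev]
  have hwρ : ‖1 - w‖ ≤ ρ := by
    rw [hwn, show y₁ - y₂ = (1 - y₂) + (-(1 - y₁)) by ring]
    refine (norm_add_le_max _ _).trans (max_le hy₂ ?_)
    rw [norm_neg]; exact hy₁
  have hest := norm_logSeries_add_le p K hθ.le hwρ
  rw [hLw, zero_add] at hest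
  -- `‖1 - w‖ ≤ θ ‖1 - w‖` with `θ < 1` forces `1 - w = 0`
  have h0 : ‖1 - w‖ = 0 := by
    by_contra hne
    have hpos : 0 < ‖1 - w‖ := lt_of_le_of_ne (norm_nonneg _) (Ne.symm hne)
    have : ‖1 - w‖ < ‖1 - w‖ := by
      calc ‖1 - w‖ ≤ ρ * (p : ℝ) ^ (1 / ((p : ℝ) - 1)) * ‖1 - w‖ := hest
        _ < 1 * ‖1 - w‖ := by gcongr
        _ = ‖1 - w‖ := one_mul _
    exact lt_irrefl _ this
  rw [hwn, norm_eq_zero, sub_eq_zero] at h0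
  exact h0

/-- **`L` maps `1 + p^λ·R` onto `p^λ·R`** when `p^{−λ}·p^{1/(p−1)} < 1` (i.e. `λ > 1/(p−1)`):
`L '' {‖1−y‖ ≤ ρ} = {‖z‖ ≤ ρ}` (surjective by `exists_logSeries_eq`, into by the Lipschitz bound) —
the classical isomorphism `log : U^{(n)} ≅ 𝔪^n`, `n > e/(p−1)`. [cite: Koblitz1984, Ch. IV §2] -/
theorem logSeries_image_closedBall {ρ : ℝ} (hθ : ρ * (p : ℝ) ^ (1 / ((p : ℝ) - 1)) < 1) :
    logSeries '' {y : K | ‖1 - y‖ ≤ ρ} = {z : K | ‖z‖ ≤ ρ} := by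
  ext z
  constructor
  · rintro ⟨y, hy, rfl⟩
    rw [Set.mem_setOf_eq] at hy ⊢
    exact (norm_logSeries_le_norm p K hθ.le hy).trans hy
  · intro hz
    rw [Set.mem_setOf_eq] at hz
    obtain ⟨u, hu, huz⟩ := exists_logSeries_eq p K hθ hz
    exact ⟨u, hu, huz⟩

end Contraction

end Literature.IUT.LogVolume

end
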